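import Summits.HodgeConjecture.HodgeConjecture.Theorems.ThreefoldSquareCodimTwoChowZero
import Literature.AlgebraicGeometry.HodgeTheory.HodgeConjectureDescendsAlongSurjections
import Literature.AlgebraicGeometry.HodgeTheory.SupportedClassesGysinSpan
import Literature.AlgebraicGeometry.HodgeTheory.GysinExteriorProduct
import Literature.AlgebraicGeometry.HodgeTheory.BettiHodgeConjectureThreefoldQZeroH20ZeroTimesVarietyCorrespondenceCriterion
import Literature.AlgebraicGeometry.HodgeTheory.BettiKunnethPieceHodgeClassActions
import Literature.AlgebraicGeometry.HodgeTheory.BettiHodgeConjectureProductAlgebraicCohomologyFactor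
import Literature.AlgebraicGeometry.HodgeTheory.BettiIrregularityHodgeTateType
import Literature.AlgebraicGeometry.HodgeTheory.BettiHodgeGroupTrivialPureTypeDegrees
import Literature.AlgebraicGeometry.HodgeTheory.KunnethComponentsOfHodgeClasses
import Literature.AlgebraicGeometry.HodgeTheory.ClassesSupportedOnComplexification
import Literature.AlgebraicGeometry.HodgeTheory.ComplexConjugationHolds
import Literature.AlgebraicGeometry.HodgeTheory.ComplexGysinHodgeType
import Literature.AlgebraicGeometry.HodgeTheory.ComplexOrientationCycleClassFacts
import Literature.AlgebraicGeometry.HodgeTheory.CurveCorrespondencePushforward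
import Literature.AlgebraicGeometry.HodgeTheory.LefschetzOneOneHolds
import Literature.AlgebraicGeometry.HodgeTheory.HypersurfaceLefschetz
import Literature.AlgebraicGeometry.Motives.HodgeTensorFactsHolds
import Literature.AlgebraicGeometry.Motives.Uniruled
import Literature.NumberTheory.Transcendental.DeRhamTheoremMultiplicative
import HarnessLib

/-!
# The middle degree of the square of a threefold: the `H³ ⊗ H³` slot of `H⁶(X × X)` is algebraic as soon as
# `N¹H³(X) = H³(X)`, and the FULL Hodge conjecture for `X × X` when `CH₀(X)` is supported on a point
# (cell `hodge-nonav`, sector SQ3, row SQ12 MID; rationally chain connected threefolds UNCONDITIONALLY)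

PROVENANCE. Cell hodge-nonav (HUMAN RULING D-0038), planner p1 g35 assignment (iv) «FINISH THE SQUARE», ROAD B3 (STATUS
2026-08-28T06:15:11Z / 06:19:13Z / 06:19:41Z), prover seat `hodge-nonav-19716-p2` (g3). SUPPORT FILE
(`--supports stmt-HodgeConjecture-19654 --as helper`). Sequel of `Theorems/ThreefoldSquareCodimTwoChowZero` (codimension `2` of the
square; there `H³(X) ⊗ H³(X) ⊂ H⁶(X × X)` — where the intermediate Jacobian lives — was explicitly left open).

THE ARGUMENT (no retraction, no correspondence composition, no Abel–Jacobi map, no hand-made Hodge–Riemann; every input a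
tree theorem):

1. `N¹H³(X) = H³(X)` (hypothesis; Bloch–Srinivas gives it when `CH₀(X)` is supported in dimension `≤ 2`, so for `CH₀ = pt`
   and for uniruled threefolds) and Deligne 8.2.8 + Hironaka (`SupportedClassesGysinSpan.exists_finite_family_of_span_le_supportedClasses`,
   unconditional): ONE finite family of smooth projective SURFACES `g_j : D_j ⟶ X` with `H³(X) = Σ_j (g_j)_* H¹(D_j)`
   (`exists_finite_family_surfaces_of_supportedClasses_three_one_eq_top`; the degree bookkeeping `a + 6 = 3 + 2m`, `m ≤ 2`
   forces `m = 2`, `a = 1`).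
2. Hence the Künneth piece `H³(X) ⊗ H³(X) ⊂ H⁶(X × X)` lies in `Σ_{j,k} im (g_j × g_k)_* [H²(D_j × D_k) → H⁶(X × X)]`
   (`kunnethPiece_three_three_le_iSup_range_complexGysin_tensorHom`): Fulton's exterior product formula
   `(g_j × g_k)_*(pr₁^* a ∪ pr₂^* b) = K · pr₁^*(g_{j*} a) ∪ pr₂^*(g_{k*} b)` with ONE `K ≠ 0`
   (`exists_complexGysin_tensorHom_cross_eq_smul`).
3. The maps `(g_j × g_k)_*` are rational Hodge-linear of Tate twist `(2, 2)`, so by the tree's Hodge-class LIFT engine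
   (`SurjectiveDescent.exists_isRationalClass_isOfHodgeType_eq_sum_int`, Voisin 2025 Cor. 2.12 — polarisations and semisimplicity
   are inside it) a RATIONAL `(3,3)`-class `c` in that sum is `Σ (g_j × g_k)_*(a_{jk})` with `a_{jk}` rational of type `(1,1)` on
   the FOURFOLD `D_j × D_k`, i.e. a divisor class (Lefschetz `(1,1)`, `lefschetzOneOne_rational_holds`); Gysin maps preserve
   algebraic classes (`complexGysin_mem_algebraicClasses_of_mem_algebraicClasses`), so `c` is algebraic
   (`hodgeThreeThree_slot_algebraic_of_supportedClasses_three_one_eq_top`).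
4. For a threefold with moreover `b₁ = 0` and `H² = N¹H²` (both again read off `CH₀ = pt`), the tree's criterion
   `BettiUniverse.hodgeConjectureFor_threefold_tensor_iff_forall_exists_corrAction_eq_of_q_zero_of_h20_zero` (`q = h^{2,0} = 0`,
   `HC(X)` in dimension `3`) reduces `HC(X × X)` in ALL codimensions to the Hodge classes of the summands `H³ ⊗ H¹ = 0` and
   `H³ ⊗ H³` — the latter handled by 3 (`hodgeConjectureFor_sq_of_supportedClasses_three_one_eq_top`).

CONTENT (sorry-free over tree theorems; no definition, no named fact, no new axiom): §1 the finite family of surfaces; §2 the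
Künneth piece inside the Gysin images; §3 **`hodgeThreeThree_slot_algebraic_of_supportedClasses_three_one_eq_top`** (ANY smooth
projective threefold with `N¹H³ = H³`), `…_of_hasChowZeroSupportedInDimLE_two`, `…_of_isUniruled` (mod Debarre's printed fact);
§4 **`hodgeConjectureFor_sq_of_supportedClasses_three_one_eq_top`**, **`hodgeConjectureFor_sq_of_hasChowZeroSupportedInDimLE_zero`**
(`HodgeConjectureFor 6 (X ⊗ X)`: EVERY codimension), **`hodgeConjectureFor_sq_of_isRationallyChainConnected`** (UNCONDITIONAL),
`hodgeConjectureFor_sq_of_isFano` (mod Kollár–Miyaoka–Mori); §5 the complement `algebraicClasses_sq_eq_top_of_ne_three` (off the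
middle codimension every class of `H^{2p}(X × X)` is algebraic when `CH₀ = pt`).

HONEST SCOPE. New CLOSED rows for the non-abelian ladder: «HC for the self-square of every rationally chain connected smooth
projective threefold, in all codimensions» (print status PRINT-IMPLIED / folklore via "the motive of such `X` is of abelian type";
assembled here polarization-free from the tree's lift engine). Nothing here proves the Hodge conjecture beyond the stated rows;
`HC` for a general threefold square (the `(2,2)`-classes already, `HC⁴(S × S)` for K3 surfaces) stays OPEN; rung F-H1 not moved.

## References

* [BlochSrinivas1983] S. Bloch, V. Srinivas, Remarks on correspondences and algebraic cycles, Amer. J. Math. 105 (1983), Thm. 1.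
* [DeligneHodgeIII1974] P. Deligne, Théorie de Hodge III, Publ. Math. IHÉS 44 (1974), Cor. 8.2.8.
* [Voisin2025] C. Voisin, Cycle classes on algebraic varieties (2025), §2.1, Prop. 2.11, Cor. 2.12, §3.2.1.
* [VoisinHodgeI2002] C. Voisin, Hodge Theory and Complex Algebraic Geometry I (2002), §7.3.2, §11.3.3 Thm. 11.38–11.41.
* [VoisinHodgeII2003] C. Voisin, Hodge Theory and Complex Algebraic Geometry II (2003), Thm. 10.17, Cor. 10.18, §10.2.3.
* [Fulton1998] W. Fulton, Intersection Theory (1998), §1.10 Prop. 1.10 (b), §19.2.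
* [Kollar1995] J. Kollár, Rational curves on algebraic varieties (1996), Def. IV.3.2 / 4.10.
* [KollarMiyaokaMori1992] J. Kollár, Y. Miyaoka, S. Mori, J. Differential Geom. 36 (1992), Thm. 0.1.
* [Debarre2001] O. Debarre, Higher-dimensional algebraic geometry (2001), Remarks 4.2 (4).
-/

set_option linter.dupNamespace false

noncomputable section

open CategoryTheory AlgebraicGeometry MonoidalCategory CartesianMonoidalCategory
open scoped TensorProduct
open Literature.AlgebraicTopology.SingularHomology
open Literature.AlgebraicGeometry Literature.AlgebraicGeometry.Motives Literature.AlgebraicGeometry.HodgeTheory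
open Literature.Barriers.HodgeConjecture
open Summit.HodgeConjecture.HodgeConjecture.Theorems

namespace Summit.HodgeConjecture.HodgeConjecture.Theorems.ThreefoldSquare

variable {X : SchemeOver ℂ}

/-! ## §1 One finite family of surfaces carrying `H³(X)` -/

/-- **`N¹H³(X) = H³(X)` ⟹ `H³(X) = Σ_j (g_j)_* H¹(D_j)` for ONE finite family of smooth projective SURFACES `g_j : D_j ⟶ X`**
(Deligne 8.2.8 + Hironaka via the tree's `exists_finite_family_of_span_le_supportedClasses`, applied to a finite spanning set of the
finite-dimensional `H³(X(ℂ); ℂ)`; a Gysin map into `H³` of a threefold from an `m`-fold with `m + 1 ≤ 3` has source degree `a`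
with `a + 6 = 3 + 2m`, forcing `m = 2`, `a = 1`). [cite: DeligneHodgeIII1974, Cor. 8.2.8] [cite: VoisinHodgeI2002, §7.3.2] -/
theorem exists_finite_family_surfaces_of_supportedClasses_three_one_eq_top (μ : OrientationFamily)
    (hX : IsSmoothProjective 3 X) (hN : supportedClasses X 3 1 = ⊤) :
    ∃ (ι : Type) (_ : Fintype ι) (D : ι → SchemeOver ℂ) (hD : ∀ j, IsSmoothProjective 2 (D j))
      (g : ∀ j, D j ⟶ X), ∀ x : complexBetti X 3,
        x ∈ ⨆ j, LinearMap.range (complexGysin μ (hD j) hX (g j) (rfl : 1 + 2 * 3 = 3 + 2 * 2)) := by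
  classical
  letI := hX.chartedSpace
  haveI := ComplexPoints.compactSpace_of_isSmoothProjective hX
  haveI := ComplexPoints.t2Space_of_isSmoothProjective hX
  haveI : Module.Finite ℂ (complexBetti X 3) :=
    finite_singularCohomology_of_compact_chartedSpace ℂ ℂ (d := 2 * 3) 3
  obtain ⟨s, hs⟩ := Module.finite_def.1 ‹Module.Finite ℂ (complexBetti X 3)›
  obtain ⟨ι, hι, m, Y, hY, g, hm, hle⟩ := exists_finite_family_of_span_le_supportedClasses μ hX (r := 1) s
    (fun x _ ↦ by rw [hN]; exact Submodule.mem_top)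
  haveI := Fintype.ofFinite ι
  -- only the surfaces contribute to `H³`
  have key : ∀ (j : ι) (m₀ : ℕ) (hY₀ : IsSmoothProjective m₀ (Y j)) (hY₂ : IsSmoothProjective 2 (Y j))
      (hm₀ : m₀ = 2) (a : ℕ) (hab : a + 2 * 3 = 3 + 2 * m₀),
      LinearMap.range (complexGysin μ hY₀ hX (g j) hab) ≤
        LinearMap.range (complexGysin μ hY₂ hX (g j) (rfl : 1 + 2 * 3 = 3 + 2 * 2)) := by
    intro j m₀ hY₀ hY₂ hm₀ a hab
    subst hm₀
    obtain rfl : a = 1 := by omega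
    exact le_rfl
  have hY₂ : ∀ j : {j : ι // m j = 2}, IsSmoothProjective 2 (Y j.1) := fun j ↦ by
    have h := hY j.1
    rw [j.2] at h
    exact h
  refine ⟨{j : ι // m j = 2}, inferInstance, fun j ↦ Y j.1, hY₂, fun j ↦ g j.1, fun x ↦ ?_⟩
  have hx : x ∈ Submodule.span ℂ (↑s : Set (complexBetti X 3)) := by rw [hs]; exact Submodule.mem_top
  have hsub : (⨆ (j : ι) (a : ℕ) (hab : a + 2 * 3 = 3 + 2 * m j), LinearMap.range (complexGysin μ (hY j) hX (g j) hab)) ≤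
      ⨆ j' : {j : ι // m j = 2}, LinearMap.range (complexGysin μ (hY₂ j') hX (g j'.1) (rfl : 1 + 2 * 3 = 3 + 2 * 2)) := by
    refine iSup_le fun j ↦ iSup_le fun a ↦ iSup_le fun hab ↦ ?_
    have hmj : m j = 2 := by have := hm j; omega
    exact (key j (m j) (hY j) (hY₂ ⟨j, hmj⟩) hmj a hab).trans
      (le_iSup (fun j' : {j : ι // m j = 2} ↦ LinearMap.range
        (complexGysin μ (hY₂ j') hX (g j'.1) (rfl : 1 + 2 * 3 = 3 + 2 * 2))) ⟨j, hmj⟩)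
  exact hsub (hle hx)

/-! ## §2 The Künneth piece `H³ ⊗ H³` inside the Gysin images of the fourfolds `D_j × D_k` -/

/-- **If `H³(X) = Σ_j (g_j)_* H¹(D_j)` then `H³(X) ⊗ H³(X) ⊂ Σ_{j,k} im (g_j × g_k)_* [H²(D_j × D_k) → H⁶(X × X)]`** (complex
orientations): a cross product `pr₁^*(g_{j*} a) ∪ pr₂^*(g_{k*} b)` is `K⁻¹ · (g_j × g_k)_*(pr₁^* a ∪ pr₂^* b)` by Fulton's exterior
product formula with its non-zero constant (`exists_complexGysin_tensorHom_cross_eq_smul`), and both sides are bilinear.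
[cite: Fulton1998, §1.10 Prop. 1.10 (b)] [cite: HatcherAT2002, §3.2 Thm. 3.16] -/
theorem kunnethPiece_three_three_le_iSup_range_complexGysin_tensorHom (hX : IsSmoothProjective 3 X)
    {ι : Type} [Fintype ι] {D : ι → SchemeOver ℂ} (hD : ∀ j, IsSmoothProjective 2 (D j)) (g : ∀ j, D j ⟶ X)
    (hsp : ∀ x : complexBetti X 3,
      x ∈ ⨆ j, LinearMap.range (complexGysin complexOrientationFamily (hD j) hX (g j) (rfl : 1 + 2 * 3 = 3 + 2 * 2))) :
    kunnethPiece X X (rfl : 3 + 3 = 2 * 3) ≤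
      ⨆ jk : ι × ι, LinearMap.range
        (complexGysin complexOrientationFamily ((hD jk.1).tensor_holds (hD jk.2)) (hX.tensor_holds hX)
          (g jk.1 ⊗ₘ g jk.2) (rfl : 2 * 1 + 2 * (3 + 3) = 2 * 3 + 2 * (2 + 2))) := by
  classical
  set W : Submodule ℂ (complexBetti (X ⊗ X) (2 * 3)) := ⨆ jk : ι × ι, LinearMap.range
    (complexGysin complexOrientationFamily ((hD jk.1).tensor_holds (hD jk.2)) (hX.tensor_holds hX)
      (g jk.1 ⊗ₘ g jk.2) (rfl : 2 * 1 + 2 * (3 + 3) = 2 * 3 + 2 * (2 + 2))) with hW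
  -- the cross product of two Gysin images is a Gysin image of the product surface
  have hgen : ∀ (j k : ι) (a : complexBetti (D j) 1) (b : complexBetti (D k) 1),
      cupProduct (rfl : 3 + 3 = 2 * 3)
        (complexBetti.map (fst X X) 3 (complexGysin complexOrientationFamily (hD j) hX (g j) rfl a))
        (complexBetti.map (snd X X) 3 (complexGysin complexOrientationFamily (hD k) hX (g k) rfl b)) ∈ W := by
    intro j k a b
    obtain ⟨K, hK0, hK⟩ := exists_complexGysin_tensorHom_cross_eq_smul (hD j) (hD k) hX hX (g j) (g k)
    have h := hK (rfl : 1 + 1 = 2 * 1) (rfl : 1 + 2 * 3 = 3 + 2 * 2) (rfl : 1 + 2 * 3 = 3 + 2 * 2)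
      (rfl : 3 + 3 = 2 * 3) (rfl : 2 * 1 + 2 * (3 + 3) = 2 * 3 + 2 * (2 + 2)) a b
    have h' : cupProduct (rfl : 3 + 3 = 2 * 3)
        (complexBetti.map (fst X X) 3 (complexGysin complexOrientationFamily (hD j) hX (g j) rfl a))
        (complexBetti.map (snd X X) 3 (complexGysin complexOrientationFamily (hD k) hX (g k) rfl b)) =
        K⁻¹ • complexGysin complexOrientationFamily ((hD j).tensor_holds (hD k)) (hX.tensor_holds hX)
          (g j ⊗ₘ g k) (rfl : 2 * 1 + 2 * (3 + 3) = 2 * 3 + 2 * (2 + 2))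
          (cupProduct (rfl : 1 + 1 = 2 * 1) (complexBetti.map (fst (D j) (D k)) 1 a)
            (complexBetti.map (snd (D j) (D k)) 1 b)) := by
      rw [h, smul_smul, inv_mul_cancel₀ hK0, one_smul]
    rw [h']
    exact Submodule.smul_mem _ _
      (Submodule.mem_iSup_of_mem (⟨j, k⟩ : ι × ι) (LinearMap.mem_range_self _ _))
  -- bilinearity
  refine Submodule.span_le.2 ?_
  rintro v ⟨x, y, rfl⟩
  have hx := hsp x
  have hy := hsp y
  have Py : ∀ x' : complexBetti X 3,
      (∃ (j : ι) (a : complexBetti (D j) 1), complexGysin complexOrientationFamily (hD j) hX (g j) rfl a = x') →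
      cupProduct (rfl : 3 + 3 = 2 * 3) (complexBetti.map (fst X X) 3 x') (complexBetti.map (snd X X) 3 y) ∈ W := by
    rintro x' ⟨j, a, rfl⟩
    induction hy using Submodule.iSup_induction' with
    | mem k y' hy' =>
      obtain ⟨b, rfl⟩ := hy'
      exact hgen j k a b
    | zero => rw [map_zero, map_zero]; exact Submodule.zero_mem _
    | add y₁ y₂ _ _ h₁ h₂ => rw [map_add, map_add]; exact Submodule.add_mem _ h₁ h₂
  induction hx using Submodule.iSup_induction' with
  | mem j x' hx' =>
    obtain ⟨a, rfl⟩ := hx'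
    exact Py _ ⟨j, a, rfl⟩
  | zero => rw [map_zero, LinearMap.map_zero₂]; exact Submodule.zero_mem _
  | add x₁ x₂ _ _ h₁ h₂ => rw [map_add, LinearMap.map_add₂]; exact Submodule.add_mem _ h₁ h₂

/-! ## §3 The `(3,3)`-slot is algebraic when `N¹H³ = H³` -/

/-- **ROW SQ12 MID on the coniveau-one locus (KERNEL): for a smooth projective threefold `X` with `N¹H³(X) = H³(X)`, every
RATIONAL class of Hodge type `(3,3)` in the Künneth piece `H³(X) ⊗ H³(X) ⊂ H⁶((X ⊗ X)(ℂ); ℂ)` is algebraic.** By §1–§2 such a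
class lies in `Σ_{j,k} im (g_j × g_k)_*` for finitely many smooth projective surfaces `D_j → X`; the Gysin maps
`(g_j × g_k)_* : H²(D_j × D_k) → H⁶(X × X)` are rational Hodge-linear of twist `(2,2)`
(`isRationalClass_complexGysin_complexOrientationFamily`, `isOfHodgeType_complexGysin`), so the tree's lift engine
(`SurjectiveDescent.exists_isRationalClass_isOfHodgeType_eq_sum_int`) writes the class as `Σ (g_j × g_k)_* a_{jk}` with `a_{jk}`
rational of type `(1,1)` on the fourfold `D_j × D_k` — divisor classes (Lefschetz `(1,1)`), whose Gysin images are algebraic.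
(statement: cell hodge-nonav row SQ12 MID; the intermediate-Jacobian slot of the square, here WITHOUT Abel–Jacobi or reducibility)
[cite: Voisin2025, Cor. 2.12 and Prop. 2.11] [cite: DeligneHodgeIII1974, Cor. 8.2.8] [cite: Fulton1998, §1.10 Prop. 1.10 (b) and §19.2]
[cite: VoisinHodgeI2002, §7.3.2 and §11.3.3 Thm. 11.38] -/
theorem hodgeThreeThree_slot_algebraic_of_supportedClasses_three_one_eq_top (hX : IsSmoothProjective 3 X)
    (hN : supportedClasses X 3 1 = ⊤) (c : complexBetti (X ⊗ X) (2 * 3))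
    (hK : c ∈ kunnethPiece X X (rfl : 3 + 3 = 2 * 3)) (hc : IsRationalClass c)
    (hH : IsOfHodgeType (3 + 3) (X ⊗ X) (2 * 3) 3 3 c) : c ∈ algebraicClasses (X ⊗ X) 3 := by
  classical
  obtain ⟨ι, _, D, hD, g, hsp⟩ :=
    exists_finite_family_surfaces_of_supportedClasses_three_one_eq_top complexOrientationFamily hX hN
  have hXX : IsSmoothProjective (3 + 3) (X ⊗ X) := hX.tensor_holds hX
  have hDD : ∀ jk : ι × ι, IsSmoothProjective (2 + 2) (D jk.1 ⊗ D jk.2) :=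
    fun jk ↦ (hD jk.1).tensor_holds (hD jk.2)
  -- the finite family of Gysin maps `(g_j × g_k)_* : H²(D_j × D_k) → H⁶(X × X)`
  set G : ∀ jk : ι × ι, complexBetti (D jk.1 ⊗ D jk.2) (2 * 1) →ₗ[ℂ] complexBetti (X ⊗ X) (2 * 3) :=
    fun jk ↦ complexGysin complexOrientationFamily (hDD jk) hXX (g jk.1 ⊗ₘ g jk.2)
      (rfl : 2 * 1 + 2 * (3 + 3) = 2 * 3 + 2 * (2 + 2)) with hG
  have hcG : c ∈ ⨆ jk, LinearMap.range (G jk) :=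
    kunnethPiece_three_three_le_iSup_range_complexGysin_tensorHom hX hD g hsp hK
  -- the lift
  obtain ⟨a, ha, hsum⟩ := SurjectiveDescent.exists_isRationalClass_isOfHodgeType_eq_sum_int hXX
    (m := fun _ : ι × ι ↦ 2 + 2) (d := fun _ ↦ 1) (Y := fun jk ↦ D jk.1 ⊗ D jk.2) hDD 3 (fun _ ↦ 2)
    (fun _ ↦ by norm_num) G
    (fun jk y hy ↦ isRationalClass_complexGysin_complexOrientationFamily (hDD jk) hXX _ _ hy)
    (fun jk ↦ by
      intro p q' y _ hy p₁ q₁ hp₁ hq₁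
      have hp₁' : (p₁ : ℤ) = p + 2 := hp₁
      have hq₁' : (q₁ : ℤ) = q' + 2 := hq₁
      exact isOfHodgeType_complexGysin hodgePQ_independent_of_hodgeModel_holds (fun _ _ ↦ nonempty_hodgeModel_holds)
        (fun E _ _ _ ↦ Literature.NumberTheory.Transcendental.exists_deRhamIsoFamily_holds E)
        complexOrientationFamily (hDD jk) hXX (g jk.1 ⊗ₘ g jk.2) _ (by omega) (by omega) hy)
    (fun jk ↦ by
      intro p q' y _ _ h
      have h' : (p : ℤ) + 2 < 0 ∨ (q' : ℤ) + 2 < 0 := h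
      exact absurd h' (by omega))
    hc hH hcG
  rw [hsum]
  refine Submodule.sum_mem _ fun jk _ ↦ ?_
  -- `a jk` is a rational `(1,1)`-class on the fourfold `D_j × D_k`: a divisor class
  have halg : a jk ∈ algebraicClasses (D jk.1 ⊗ D jk.2) 1 :=
    lefschetzOneOne_rational_holds (hDD jk) (a jk) (ha jk).1 (ha jk).2
  exact complexGysin_mem_algebraicClasses_of_mem_algebraicClasses complexOrientationFamily (hDD jk) hXX
    (g jk.1 ⊗ₘ g jk.2) (rfl : 2 * 1 + 2 * (3 + 3) = 2 * 3 + 2 * (2 + 2)) halg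

/-- The same on the locus «`CH₀(X)` supported in dimension `≤ 2`» (Bloch–Srinivas: then `N¹H³(X) = H³(X)`,
`supportedClasses_eq_top_of_hasChowZeroSupportedInDimLE_of_lt`). [cite: BlochSrinivas1983, Thm. 1 (2)]
[cite: VoisinHodgeII2003, Thm. 10.17 and §10.2.3] -/
theorem hodgeThreeThree_slot_algebraic_of_hasChowZeroSupportedInDimLE_two (hX : IsSmoothProjective 3 X)
    (hW : HasChowZeroSupportedInDimLE X 2) (c : complexBetti (X ⊗ X) (2 * 3))
    (hK : c ∈ kunnethPiece X X (rfl : 3 + 3 = 2 * 3)) (hc : IsRationalClass c)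
    (hH : IsOfHodgeType (3 + 3) (X ⊗ X) (2 * 3) 3 3 c) : c ∈ algebraicClasses (X ⊗ X) 3 :=
  hodgeThreeThree_slot_algebraic_of_supportedClasses_three_one_eq_top hX
    (supportedClasses_eq_top_of_hasChowZeroSupportedInDimLE_of_lt hX hW (by norm_num)) c hK hc hH

/-- **UNIRULED threefolds, modulo Debarre's printed fact** (a rational curve through every point ⇒ `CH₀` supported on a surface,
`Debarre2001_uniruled_rationalCurve_through_every_point.hasChowZeroSupportedInDimLE`): the rational `(3,3)`-classes of the
Künneth piece `H³(X) ⊗ H³(X)` are algebraic. CONDITIONAL on that named fact. [cite: Debarre2001, Remarks 4.2 (4)]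
[cite: VoisinHodgeII2003, remark following Prop. 10.26 (§10.2.3)] [cite: BlochSrinivas1983, Thm. 1 (2)] -/
theorem hodgeThreeThree_slot_algebraic_of_isUniruled (hDeb : Debarre2001_uniruled_rationalCurve_through_every_point)
    (hX : IsSmoothProjective 3 X) (hU : IsUniruled X) (c : complexBetti (X ⊗ X) (2 * 3))
    (hK : c ∈ kunnethPiece X X (rfl : 3 + 3 = 2 * 3)) (hc : IsRationalClass c)
    (hH : IsOfHodgeType (3 + 3) (X ⊗ X) (2 * 3) 3 3 c) : c ∈ algebraicClasses (X ⊗ X) 3 :=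
  hodgeThreeThree_slot_algebraic_of_hasChowZeroSupportedInDimLE_two hX (hDeb.hasChowZeroSupportedInDimLE hX hU) c hK hc hH

/-! ## §4 The full Hodge conjecture for `X × X` -/

/-- **`HC(X × X)` in EVERY codimension for a smooth projective threefold with `b₁(X) = 0`, `H²(X) = N¹H²(X)` and
`N¹H³(X) = H³(X)`.** The tree's criterion for `T × Z` with `q(T) = h^{2,0}(T) = 0` and `HC(Z)` (`Z = X`, `HC` in dimension `3`)
leaves the Hodge classes of the summands `H³(X) ⊗ H¹(X) = 0` and `H³(X) ⊗ H³(X)` (§3); `q = 0` from `b₁ = 0` (universal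
coefficients), `h^{2,0} = 0` from `H² = N¹H²` (algebraic classes are Hodge classes). [cite: VoisinHodgeI2002, §11.3.3 Thm. 11.38–11.41]
[cite: Voisin2025, §3.2.1 and Cor. 2.12] [cite: DeligneHodgeIII1974, Cor. 8.2.8] -/
theorem hodgeConjectureFor_sq_of_supportedClasses_three_one_eq_top (hX : IsSmoothProjective 3 X)
    (h₁ : Subsingleton (complexBetti X 1)) (h₂ : algebraicClasses X 1 = ⊤) (h₃ : supportedClasses X 3 1 = ⊤) :
    HodgeConjectureFor 6 (X ⊗ X) := by
  haveI : HodgeTensorFacts.{0, 0} := hodgeTensorFacts_holds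
  have hHD : exists_isReal_hodgeModel := exists_isReal_hodgeModel_holds
  have hXX : IsSmoothProjective 6 (X ⊗ X) := hX.tensor_holds hX
  haveI := BettiUniverse.finite hX 1
  -- `b₁ = 0`
  have hb₁ : Module.finrank ℚ (bettiCohomology X 1) = 0 := by
    have e : Module.finrank ℂ (complexBetti X 1) = Module.finrank ℚ (bettiCohomology X 1) := by
      rw [← (ofRatClassBaseChangeEquiv hX 1).finrank_eq, Module.finrank_baseChange]
    rw [← e]
    exact Module.finrank_zero_of_subsingleton
  have h10 : (BettiUniverse.hodge hHD hX 1).hodgeNumber 1 0 = 0 :=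
    (BettiUniverse.finrank_bettiCohomology_one_eq_zero_iff hHD hX).1 hb₁
  -- `h^{2,0} = 0`
  have h11 : (BettiUniverse.hodge hHD hX (2 * 1)).hodgeClasses 1 = ⊤ :=
    BettiUniverse.hodgeClasses_hodge_eq_top_of_algebraicClasses_eq_top hHD hX h₂
  have h20 : (BettiUniverse.hodge hHD hX 2).hodgeNumber 2 0 = 0 :=
    (BettiUniverse.hodgeClasses_hodge_two_eq_top_iff hHD hX).1 (by simpa using h11)
  refine (BettiUniverse.hodgeConjectureFor_threefold_tensor_iff_forall_exists_corrAction_eq_of_q_zero_of_h20_zero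
    complexOrientationFamily hHD hX hX hXX (hodgeConjectureFor_of_dim_le_three_holds le_rfl hX) h10 h20).2 ?_
  intro c j a hj hab hj₁ hj₃ t ht
  refine ⟨BettiUniverse.crossMap X X hj t, ?_, rfl⟩
  obtain rfl | rfl : j = 1 ∨ j = 3 := by omega
  · -- the summand `H³ ⊗ H¹ = 0`
    haveI : Subsingleton (bettiCohomology X 1) := Module.finrank_zero_iff.1 hb₁
    have ht0 : ∀ u : bettiCohomology X 3 ⊗[ℚ] bettiCohomology X 1, u = 0 := fun u ↦ by
      induction u using TensorProduct.induction_on with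
      | zero => rfl
      | tmul x y => rw [Subsingleton.elim y 0, TensorProduct.tmul_zero]
      | add x y hx hy => rw [hx, hy, add_zero]
    rw [ht0 t, map_zero, map_zero]
    exact Submodule.zero_mem _
  · obtain rfl : c = 3 := by omega
    exact hodgeThreeThree_slot_algebraic_of_supportedClasses_three_one_eq_top hX h₃ _
      (ofRatClass_crossMap_mem_kunnethPiece hj t) (isRationalClass_ofRatClass _)
      ((BettiUniverse.mem_hodgeClasses_kunnethSummand_iff_isOfHodgeType hHD hX hX hj t).1 ht)

/-- **ROW (KERNEL): the FULL Hodge conjecture for `X × X`, `X` a smooth projective threefold with `CH₀(X)` supported on a point**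
(`H¹ = 0`, `H² = N¹`, `N¹H³ = H³` all by Bloch–Srinivas + semipurity). (statement: cell hodge-nonav row SQ12 on the `CH₀ = pt` locus;
print status: folklore via "the motive of `X` is of abelian type", assembled here without it) [cite: BlochSrinivas1983, Thm. 1]
[cite: VoisinHodgeII2003, Thm. 10.17 and Cor. 10.18] [cite: Voisin2025, Cor. 2.12] -/
theorem hodgeConjectureFor_sq_of_hasChowZeroSupportedInDimLE_zero (hX : IsSmoothProjective 3 X)
    (hW : HasChowZeroSupportedInDimLE X 0) : HodgeConjectureFor 6 (X ⊗ X) :=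
  hodgeConjectureFor_sq_of_supportedClasses_three_one_eq_top hX
    (subsingleton_complexBetti_one_of_hasChowZeroSupportedInDimLE_zero hX hW)
    (algebraicClasses_one_eq_top_of_hasChowZeroSupportedInDimLE_zero hX hW)
    (supportedClasses_eq_top_of_hasChowZeroSupportedInDimLE_of_lt hX hW (by norm_num))

/-- **Rationally chain connected smooth projective threefolds, UNCONDITIONALLY: the Hodge conjecture holds for `X × X` in every
codimension** (`IsRationallyChainConnected.hasChowZeroSupportedInDimLE_zero`: `CH₀ = ℤ`). [cite: Kollar1995, Def. IV.3.2 (4.10)]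
[cite: BlochSrinivas1983, Thm. 1] [cite: Voisin2025, Cor. 2.12] -/
theorem hodgeConjectureFor_sq_of_isRationallyChainConnected (hX : IsSmoothProjective 3 X)
    (hRC : IsRationallyChainConnected X) : HodgeConjectureFor 6 (X ⊗ X) :=
  hodgeConjectureFor_sq_of_hasChowZeroSupportedInDimLE_zero hX (hRC.hasChowZeroSupportedInDimLE_zero hX)

/-- **Smooth Fano threefolds, modulo Kollár–Miyaoka–Mori** (Fano ⇒ rationally chain connected, the named fact
`KollarMiyaokaMori1992_fano_rationallyChainConnected`): the Hodge conjecture for `X × X` in every codimension. CONDITIONAL on that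
fact. [cite: KollarMiyaokaMori1992, Thm. 0.1] [cite: BlochSrinivas1983, Thm. 1] -/
theorem hodgeConjectureFor_sq_of_isFano (hK : KollarMiyaokaMori1992_fano_rationallyChainConnected)
    (hF : IsFano 3 X) : HodgeConjectureFor 6 (X ⊗ X) :=
  hodgeConjectureFor_sq_of_isRationallyChainConnected hF.isSmoothProjective (hK hF)

/-! ## §5 Off the middle codimension every class of the square is algebraic -/

/-- **For a smooth projective threefold with `CH₀(X)` supported on a point, EVERY class of `H^{2p}((X ⊗ X)(ℂ); ℂ)`, `p ≠ 3`, is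
algebraic** (Künneth slots: `H¹ = H⁵ = 0`, `H⁰, H², H⁴, H⁶` spanned by algebraic classes; the only odd–odd slot of the square is
`(3,3)` in degree `6`). Complements `algebraicClasses_sq_two_eq_top_of_hasChowZeroSupportedInDimLE_zero` (`p = 2`).
[cite: BlochSrinivas1983, Thm. 1] [cite: VoisinHodgeII2003, proof of Prop. 9.20] -/
theorem algebraicClasses_sq_eq_top_of_ne_three (hX : IsSmoothProjective 3 X) (hW : HasChowZeroSupportedInDimLE X 0)
    {p : ℕ} (hp : p ≠ 3) : algebraicClasses (X ⊗ X) p = ⊤ := by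
  have h₁ := subsingleton_complexBetti_one_of_hasChowZeroSupportedInDimLE_zero hX hW
  have h₂ := algebraicClasses_one_eq_top_of_hasChowZeroSupportedInDimLE_zero hX hW
  have h₄ := algebraicClasses_two_eq_top_of_hasChowZeroSupportedInDimLE_zero hX hW
  have h₅ := subsingleton_complexBetti_five hX h₁
  -- even degrees are algebraic, odd degrees other than `3` vanish, degrees `> 6` vanish
  have heven : ∀ l : ℕ, algebraicClasses X l = ⊤ := by
    intro l
    rcases Nat.lt_or_ge l 3 with hl | hl
    · interval_cases l
      · exact algebraicClasses_zero
      · exact h₂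
      · exact h₄
    · exact algebraicClasses_eq_top_of_eq_zero_or_le hX (Or.inr hl)
  have hodd : ∀ i : ℕ, i ≠ 3 → ¬ 2 ∣ i → Subsingleton (complexBetti X i) := by
    intro i hi3 hi
    rcases Nat.lt_or_ge i 7 with hi7 | hi7
    · interval_cases i <;> first | exact h₁ | exact h₅ | (exfalso; omega)
    · exact ComplexPoints.subsingleton_singularCohomology_of_lt hX ℂ (k := i) (by omega)
  refine algebraicClasses_tensor_eq_top_of_slots hX hX p fun i j hij ↦ ?_
  by_cases hi : 2 ∣ i
  · obtain ⟨l, rfl⟩ := hi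
    obtain ⟨k, rfl⟩ : ∃ k, j = 2 * k := ⟨j / 2, by omega⟩
    exact Or.inr (Or.inr ⟨l, k, rfl, rfl, heven l, heven k⟩)
  · by_cases hi3 : i = 3
    · subst hi3
      have hj3 : j ≠ 3 := by omega
      exact Or.inr (Or.inl (hodd j hj3 (by omega)))
    · exact Or.inl (hodd i hi3 hi)

end Summit.HodgeConjecture.HodgeConjecture.Theorems.ThreefoldSquare

end
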